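import Summits.QuantumFields.BalabanUV.T4Continuum.Support.AveragingDeficitBlockDensity
import Summits.QuantumFields.BalabanUV.T4Continuum.Support.BlockAveragePushDirGauge
import Literature.MathematicalPhysics.QuantumFieldTheory.Balaban1983to89.B8Lemma1NonAbelian
import HarnessLib

/-!
# T⁴ programme, node NE3 — row E-MLw-(w4)P, sub-row C0: THE COMB-GAUGE KIT OF A (DOUBLE) BLOCK AT SCALE `M`

NE3 (node U1b) formalisation swarm `b2b-balaban-t4-ne3-formalise-*`, leaf seat `b2b-balaban-t4-ne3-formalise-leaf-01`
(gen 5), row **C0** of the owner's design `HOME/t4/b2b-balaban-t4-ne3-p1/g21/D-ne3p1-g21-1.md` §3–§4 (RULING ρ-g21-2,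
`HOME/CLAIMS.log` l.15420; my CLAIM l.15469; SHAPE `HOME/t4/formal/NE3/Statements/C0-COMB-GAUGE-SHAPE-v1.md`).

WHY.  The curved twin (rows C1–C6 of the design) of the flat adjoint–spline–Landau chain works on ONE block `B(z)` of side
`M = L^k` (corner `q = M•z`), on a DOUBLE block `B(z) ∪ B(z + e_κ)` (the order interval `[q, q + pairTop M κ]`), or on a
`κ`-line of blocks, always in the COMB (complete axial, B5 (1.7)/B7 p. 24) GAUGE from the corner: the background `W` becomes
`W₀ = W^{u}`, `u = W(Γ_{q,·})` (the tree's `btree M W z = axialFn W q`), which is `1` on the comb and within `|x − q|₁·a`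
of `1` on every other bond of the small-field class `|W(∂p) − 1| ≤ a`; the gauge-invariant reading of the same numbers is the
holonomy of the COMB LOOP `Γ_{q,x} ∪ b ∪ Γ_{q,x+e_μ}⁻¹` of each bond `b = (x, μ)`, and the located inequality (μK) of the
design pairs the frame potential against the COMB-LOOP DEFECTS `(Ad_{W(loop_b)^{±1}} − 1)(·)`.  THIS FILE is the kinematic
kit those rows consume (0 `def`, 0 `sorry`, all [folklore] over the tree's B7/B8 transcriptions BY NAME):

§1 double-block geometry at scale `M`: `|lowPart μ v|₁ ≤ (d−1)(M−1) + [κ<μ]·M ≤ d·M` on `0 ≤ v ≤ pairTop M κ`, `≤ (d−1)(M−1)`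
   on the single block;
§2 the comb gauge `gaugeAct (btree M W z) W`: unitary, small-field, `= 1` on comb bonds, holonomies from the corner;
§3 THE BOND BOUND `‖W₀(x,μ) − 1‖ ≤ |lowPart μ (x − q)|₁·a` (`B8Lemma1NonAbelian.axial_bond_bound_sharp` BY NAME) and its
   uniform forms `(d−1)(M−1)·a` / `d·M·a`; `κ`-lines `‖W₀([x, x + i e_κ]) − 1‖ ≤ i·|lowPart κ (x − q)|₁·a`;
§4 the LOG FORM `W₀(b) = exp A(b)`, `‖A(b)‖ ≤ 2·|…|₁·a`, `A(b)` skew;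
§5 COMB LOOPS: `W(Γ_{q,x} b Γ_{q,x+e_μ}⁻¹) = W₀(b)` EXACTLY, hence the gauge-invariant defect bounds
   `‖Ad_{W(loop_b)^{±1}} X − X‖ ≤ 2·|lowPart μ (x − q)|₁·a·‖X‖`;
(file 2 `NE3CombGaugeCharge`: §6 the comb-transported corner charge `Φ(x) = Ad_{btree(x)⁻¹} m` and the EXACT formula
`gaugeDir W Φ (x,μ) = Ad_{btree(x+e_μ)⁻¹}(Ad_{W₀(x,μ)⁻¹} m − m)` behind (C4a); §7 the defect functional `K_B` in `ℓ¹`/`ℓ²` form.)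

HONEST FRAMING.  Kinematics of B7 p. 24 at scale `M` on our lattice objects ([folklore]; context [Balaban1985Averaging] (8) p. 18,
p. 24–25, (45) p. 24; [Balaban1985RegularSpaces] (1.23) p. 79); no estimate of NE3's; nothing about Bałaban's minimisers;
(P_W), (ML_w), T-E_w, (μK) and **NE3 are NOT proved**; spine PROVED 0∕9; finite T⁴ rung (B)+1 — NOT infinite volume, NOT mass
gap, NOT `BetaPertH`, NOT Clay.  PLACEMENT: `Summits/QuantumFields/BalabanUV/`; imports row NE3-R2's `AveragingDeficitBlockDensity`
(`btree`), leaf-10's `BlockAveragePushDirGauge` (`gaugeDir`) and the Literature transcription `B8Lemma1NonAbelian` BY NAME.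
HONEST DEPENDENCY (cell page 1): continuum YM on T⁴ ⇐ BetaPertH ∧ nine spine estimates (0/9 proved); BetaPertH ⇐ (D1) ∧ (D4) ∧
CAP+tail; G-an2-4 gates asym, D1 and NE2/3/4.
-/

set_option autoImplicit false

open scoped BigOperators Matrix Matrix.Norms.L2Operator
open NormedSpace Finset

namespace Summit.QuantumFields.BalabanUV.T4Continuum.NE3CombGauge

open Literature.MathematicalPhysics.QuantumFieldTheory.Balaban1983to89
open B7Prop1Explicit B7Prop2Explicit MatrixLog
open B8Lemma1NonAbelian (lowPart lowPart_apply lowPart_add lowPart_nonneg lowPart_le_self lowPart_zsmul_e_of_le l1_lowPart_eq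
  PlaqSmall axial_bond_bound_sharp axial_treeBond_eq_one norm_axial_seg_sub_one_le pairTop boxVec_nonneg boxVec_le_pairTop
  boxVec_add_seg_le_pairTop zsmul_e_nonneg)
open T4AveragingDeficitWall (IsUnitaryCfg SmallField Ad)
open T4AveragingDeficitNonAbelian (Ad_mul Ad_sub)
open AveragingDeficitNearIdentity (Ad_one norm_Ad_sub_le)
open AveragingDeficitTransport (norm_Ad_of_unitary mem_U1_of_unitary Ad_mem_skewAdjoint)
open AveragingDeficitBlockDensity (btree btree_eq_axialFn btree_mem)
open SpreadLiftDirection (isUnitaryCfg_gaugeAct')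
open BlockAveragePushDirGauge (gaugeDir)

noncomputable section

variable {d : ℕ} {n : Type*} [Fintype n] [DecidableEq n]

/-! ## §1 Double-block geometry at scale `M` -/

/-- `Σ_κ [κ < μ]·c ≤ (d − 1)·c` for `c ≥ 0`: the term `κ = μ` is absent. [folklore] -/
theorem sum_ite_lt_le (μ : Fin d) {c : ℝ} (hc : 0 ≤ c) :
    ∑ κ : Fin d, (if κ < μ then c else 0) ≤ ((d : ℝ) - 1) * c := by
  have hμ : μ ∈ (univ : Finset (Fin d)) := mem_univ μ
  rw [← add_sum_erase _ _ hμ, if_neg (lt_irrefl μ), zero_add]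
  calc ∑ κ ∈ univ.erase μ, (if κ < μ then c else 0) ≤ ∑ _κ ∈ univ.erase μ, c :=
        sum_le_sum fun κ _ => by split_ifs <;> linarith
    _ = ((d : ℝ) - 1) * c := by
        rw [sum_const, card_erase_of_mem hμ, card_univ, Fintype.card_fin, nsmul_eq_mul]
        have hd : 1 ≤ d := Fin.pos μ
        push_cast [Nat.cast_sub hd]; ring

/-- **Single block**: for `0 ≤ v ≤ (M−1)·𝟙`, `|lowPart μ v|₁ ≤ (d−1)(M−1)` — at most `d − 1` lower coordinates, each `≤ M − 1`.
[folklore] -/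
theorem l1_lowPart_le_single {M : ℕ} (μ : Fin d) {v : Site d} (hv0 : 0 ≤ v) (hv : v ≤ fun _ => (M : ℤ) - 1) :
    (l1 (lowPart μ v) : ℝ) ≤ ((d : ℝ) - 1) * ((M : ℝ) - 1) := by
  have hM : (0 : ℝ) ≤ (M : ℝ) - 1 := by
    have h0 : v μ ≤ (M : ℤ) - 1 := hv μ
    have h1 : (0 : ℤ) ≤ v μ := hv0 μ
    have : (1 : ℤ) ≤ M := by linarith
    exact_mod_cast sub_nonneg.mpr this
  rw [l1_lowPart_eq]; push_cast
  refine le_trans (sum_le_sum fun κ _ => ?_) (sum_ite_lt_le μ hM)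
  split_ifs with h
  · have h1 := hv0 κ; have h2 := hv κ; simp only [Pi.zero_apply] at h1 h2
    rw [Nat.cast_natAbs, Int.cast_abs, abs_of_nonneg (by exact_mod_cast h1)]
    have : ((v κ : ℤ) : ℝ) ≤ (M : ℝ) - 1 := by exact_mod_cast h2
    exact this
  · simp

/-- **Double block** `[0, pairTop M κ]` (`pairTop M κ = (M−1, …, 2M−1 (coordinate κ), …, M−1)`): `|lowPart μ v|₁ ≤ (d−1)(M−1) + [κ<μ]·M`
— the doubled coordinate enters only for bond directions `μ > κ`. [folklore] -/
theorem l1_lowPart_le_pair {M : ℕ} (κ μ : Fin d) {v : Site d} (hv0 : 0 ≤ v) (hv : v ≤ pairTop M κ) :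
    (l1 (lowPart μ v) : ℝ) ≤ ((d : ℝ) - 1) * ((M : ℝ) - 1) + (if κ < μ then (M : ℝ) else 0) := by
  have hM1 : (1 : ℤ) ≤ M := by
    have h0 : v κ ≤ pairTop M κ κ := hv κ
    have h1 : (0 : ℤ) ≤ v κ := hv0 κ
    simp only [pairTop, if_true] at h0; omega
  have hM : (0 : ℝ) ≤ (M : ℝ) - 1 := by exact_mod_cast sub_nonneg.mpr hM1
  rw [l1_lowPart_eq]; push_cast
  have key : ∀ κ' : Fin d, (if κ' < μ then (((v κ').natAbs : ℕ) : ℝ) else 0)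
      ≤ (if κ' < μ then (M : ℝ) - 1 else 0) + (if κ' = κ then (if κ < μ then (M : ℝ) else 0) else 0) := by
    intro κ'
    have h1 := hv0 κ'; have h2 := hv κ'; simp only [Pi.zero_apply, pairTop] at h1 h2
    by_cases hlt : κ' < μ
    · rw [if_pos hlt, if_pos hlt]
      have e1 : (((v κ').natAbs : ℕ) : ℝ) = ((v κ' : ℤ) : ℝ) := by
        rw [Nat.cast_natAbs, Int.cast_abs, abs_of_nonneg (by exact_mod_cast h1)]
      rw [e1]
      by_cases hκ : κ' = κ
      · subst hκ; rw [if_pos rfl, if_pos hlt]; rw [if_pos rfl] at h2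
        have : ((v κ' : ℤ) : ℝ) ≤ 2 * (M : ℝ) - 1 := by exact_mod_cast h2
        linarith
      · rw [if_neg hκ]; rw [if_neg hκ] at h2
        have : ((v κ' : ℤ) : ℝ) ≤ (M : ℝ) - 1 := by exact_mod_cast h2
        linarith
    · rw [if_neg hlt, if_neg hlt]
      have : (0 : ℝ) ≤ M := Nat.cast_nonneg M
      split_ifs <;> linarith
  refine (sum_le_sum fun κ' _ => key κ').trans ?_
  rw [sum_add_distrib, Fintype.sum_ite_eq']
  exact add_le_add (sum_ite_lt_le μ hM) le_rfl

/-- **Double block, uniform**: `|lowPart μ v|₁ ≤ d·M` on `[0, pairTop M κ]`. [folklore] -/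
theorem l1_lowPart_le_pair' {M : ℕ} (κ μ : Fin d) {v : Site d} (hv0 : 0 ≤ v) (hv : v ≤ pairTop M κ) :
    (l1 (lowPart μ v) : ℝ) ≤ (d : ℝ) * M := by
  have hd : (1 : ℝ) ≤ d := by exact_mod_cast Fin.pos μ
  have hM1 : (1 : ℝ) ≤ M := by
    have h0 : v κ ≤ pairTop M κ κ := hv κ
    have h1 : (0 : ℤ) ≤ v κ := hv0 κ
    simp only [pairTop, if_true] at h0
    have : (1 : ℤ) ≤ M := by omega
    exact_mod_cast this
  refine (l1_lowPart_le_pair κ μ hv0 hv).trans ?_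
  split_ifs <;> nlinarith

/-- Sites of the block and of its `κ`-neighbour in corner coordinates: `0 ≤ boxVec M r (+ j•e_κ) ≤ pairTop M κ` for `j ≤ M`.
[folklore] -/
theorem boxVec_add_le_pairTop (M : ℕ) (κ : Fin d) (r : Fin d → Fin M) {j : ℕ} (hj : j ≤ M) :
    (0 : Site d) ≤ boxVec M r + (j : ℤ) • e κ ∧ boxVec M r + (j : ℤ) • e κ ≤ pairTop M κ := by
  refine ⟨fun κ' => ?_, fun κ' => ?_⟩
  · have := boxVec_nonneg M r κ'; have h2 := zsmul_e_nonneg (n := (j : ℤ)) (by positivity) κ κ'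
    simp only [Pi.add_apply, Pi.zero_apply] at this h2 ⊢; linarith
  · have h1 := boxVec_add_seg_le_pairTop M κ r κ'; have h0 := boxVec_le_pairTop M κ r κ'
    simp only [Pi.add_apply, B8Lemma1NonAbelian.zsmul_e_apply] at h1 ⊢
    split_ifs with h
    · rw [if_pos h] at h1; have : (j : ℤ) ≤ M := by exact_mod_cast hj
      linarith
    · linarith

/-- Comb bonds: `lowPart μ v = 0` iff the coordinates of `v` below `μ` vanish; in particular EVERY bond of direction `0` (when
`0 < d`) lies on the comb. [folklore] -/
theorem lowPart_eq_zero_iff (μ : Fin d) (v : Site d) : lowPart μ v = 0 ↔ ∀ κ, κ < μ → v κ = 0 := by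
  constructor
  · intro h κ hκ; have := congr_fun h κ; simpa [lowPart_apply, hκ] using this
  · intro h; funext κ; simp only [lowPart_apply, Pi.zero_apply]; split_ifs with hκ
    · exact h κ hκ
    · rfl

/-- Every bond in the lowest direction is a comb bond: `lowPart ⟨0, _⟩ v = 0`. [folklore] -/
theorem lowPart_zero_dir (hd : 0 < d) (v : Site d) : lowPart (⟨0, hd⟩ : Fin d) v = 0 :=
  (lowPart_eq_zero_iff _ v).mpr fun κ hκ => absurd (show (κ : ℕ) < 0 from hκ) (Nat.not_lt_zero _)

/-! ## §2 The comb gauge of the block of `z` at scale `M` -/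

section Comb

variable {G : Type*} [Group G]

/-- **THE COMB LOOP OF A BOND IS ITS AXIAL-GAUGE VARIABLE**: for every base `q` and bond `b = (x, μ)`, the closed word
`Γ_{q,x} · b · Γ_{q,x+e_μ}⁻¹` has holonomy EXACTLY `(W^{v₀})(b)`, `v₀ = axialFn W q` (any group; (8) along the tree contours).
[cite: Balaban1985Averaging, (8) p.18, p.24] -/
theorem hol_combLoop_eq_gaugeAct_axialFn (W : Site d → Fin d → G) (q x : Site d) (μ : Fin d) :
    hol W q (treeWord (x - q) ++ (μ, true) :: revWord (treeWord (x + e μ - q))) = gaugeAct (axialFn W q) W x μ := by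
  rw [hol_append, hol_cons, disp_treeWord, stepHol_true,
    hol_revWord' W (x := q) _ (treeWord (x + e μ - q)) (by rw [disp_treeWord]; abel)]
  simp only [gaugeAct, axialFn, add_sub_cancel, mul_assoc]

end Comb

/-- The comb gauge at scale `M` from the block corner `q = M•z` IS the axial gauge at `q`:
`gaugeAct (btree M W z) W = gaugeAct (axialFn W (M•z)) W` (definitional). [folklore] -/
theorem gaugeAct_btree_eq (M : ℕ) (W : Site d → Fin d → (Matrix n n ℂ)ˣ) (z : Site d) :
    gaugeAct (btree M W z) W = gaugeAct (axialFn W ((M : ℤ) • z)) W := rfl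

/-- **COMB LOOPS AT SCALE `M`**: `W(Γ_{M•z,x} · b · Γ_{M•z,x+e_μ}⁻¹) = (W^{btree})(x, μ)`. [cite: Balaban1985Averaging, (8) p.18, p.24] -/
theorem hol_combLoop_eq (M : ℕ) (W : Site d → Fin d → (Matrix n n ℂ)ˣ) (z x : Site d) (μ : Fin d) :
    hol W ((M : ℤ) • z) (treeWord (x - (M : ℤ) • z) ++ (μ, true) :: revWord (treeWord (x + e μ - (M : ℤ) • z)))
      = gaugeAct (btree M W z) W x μ :=
  hol_combLoop_eq_gaugeAct_axialFn W _ x μ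

/-- The comb gauge of `U(N)` data is `U(N)`-valued. [folklore] -/
theorem isUnitaryCfg_comb {W : Site d → Fin d → (Matrix n n ℂ)ˣ} (hW : IsUnitaryCfg W) (M : ℕ) (z : Site d) :
    IsUnitaryCfg (gaugeAct (btree M W z) W) :=
  isUnitaryCfg_gaugeAct' (fun x => btree_mem hW M z x) hW

/-- The comb gauge preserves the small-field class (plaquette variables are conjugated by the unitary `btree`).
[cite: Balaban1985Averaging, (44)–(45) p.24] -/
theorem smallField_comb [Nonempty n] {W : Site d → Fin d → (Matrix n n ℂ)ˣ} (hW : IsUnitaryCfg W) {a : ℝ} (hWa : SmallField W a)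
    (M : ℕ) (z : Site d) : SmallField (gaugeAct (btree M W z) W) a := by
  intro x κ κ' hne
  rw [hol_gaugeAct_closed _ _ _ _ (disp_plaqWord κ κ'), Units.val_mul, Units.val_mul]
  exact (norm_units_conj_sub_one_le (mem_U1_of_unitary (btree_mem hW M z x)) _).trans (hWa x κ κ' hne)

/-- **THE COMB BONDS ARE TRIVIAL**: `(W^{btree})(x, μ) = 1` whenever `(x − M•z)_κ = 0` for all `κ < μ` (every bond of the
lowest direction; the tree's `axial_treeBond_eq_one`). [cite: Balaban1985Averaging, p.24] -/
theorem comb_eq_one_of_lowPart (M : ℕ) (W : Site d → Fin d → (Matrix n n ℂ)ˣ) (z x : Site d) (μ : Fin d)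
    (h : lowPart μ (x - (M : ℤ) • z) = 0) : gaugeAct (btree M W z) W x μ = 1 :=
  axial_treeBond_eq_one W _ x μ h

/-- At the corner the comb transport is `1`. [folklore] -/
theorem btree_corner (M : ℕ) (W : Site d → Fin d → (Matrix n n ℂ)ˣ) (z : Site d) : btree M W z ((M : ℤ) • z) = 1 := by
  rw [btree_eq_axialFn, axialFn, sub_self, treeWord_zero, hol_nil]

/-- Holonomies from the corner in the comb gauge: `W^{btree}(Γ) = W(Γ) · btree(Γ₊)⁻¹` ((8) with `btree(q) = 1`).
[cite: Balaban1985Averaging, (8) p.18] -/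
theorem hol_comb_corner (M : ℕ) (W : Site d → Fin d → (Matrix n n ℂ)ˣ) (z : Site d) (w : List (Letter d)) :
    hol (gaugeAct (btree M W z) W) ((M : ℤ) • z) w = hol W ((M : ℤ) • z) w * (btree M W z ((M : ℤ) • z + disp w))⁻¹ := by
  rw [hol_gaugeAct, btree_corner, one_mul]

/-- General holonomies in the comb gauge: `W^{btree}(Γ from x) = btree(x) · W(Γ) · btree(x + disp Γ)⁻¹`. [cite: Balaban1985Averaging, (8) p.18] -/
theorem hol_comb (M : ℕ) (W : Site d → Fin d → (Matrix n n ℂ)ˣ) (z x : Site d) (w : List (Letter d)) :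
    hol (gaugeAct (btree M W z) W) x w = btree M W z x * hol W x w * (btree M W z (x + disp w))⁻¹ :=
  hol_gaugeAct _ _ _ _

/-! ## §3 The bond bound in the comb gauge -/

section Small

variable [Nonempty n] {M : ℕ} {W : Site d → Fin d → (Matrix n n ℂ)ˣ} (hW : IsUnitaryCfg W) {a : ℝ} (hWa : SmallField W a)

omit [Nonempty n] in
include hWa in
/-- The global small-field class gives the local plaquette hypothesis of B8 on every order interval. [folklore] -/
theorem plaqSmall_of_smallField (lo hi : Site d) : PlaqSmall W lo hi a := fun x κ μ hne _ _ => hWa x κ μ hne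

include hW hWa

/-- **THE BOND BOUND IN THE COMB GAUGE (sharp)**: for `M•z ≤ x`, `‖(W^{btree})(x, μ) − 1‖ ≤ |lowPart μ (x − M•z)|₁ · a` —
non-abelian Stokes along the last legs of the comb (the tree's `axial_bond_bound_sharp` BY NAME). [cite: Balaban1985Averaging, pp.24–25] -/
theorem norm_comb_sub_one_le (z : Site d) {x : Site d} (hx : (M : ℤ) • z ≤ x) (μ : Fin d) :
    ‖((gaugeAct (btree M W z) W x μ : (Matrix n n ℂ)ˣ) : Matrix n n ℂ) - 1‖ ≤ l1 (lowPart μ (x - (M : ℤ) • z)) * a :=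
  axial_bond_bound_sharp W (fun y κ => mem_U1_of_unitary (hW y κ)) (plaqSmall_of_smallField hWa _ _) _ x μ le_rfl hx le_rfl

/-- **Single block, uniform**: on `M•z ≤ x ≤ M•z + (M−1)·𝟙`, `‖(W^{btree})(x, μ) − 1‖ ≤ (d−1)(M−1)·a`.
[cite: Balaban1985Averaging, pp.24–25] -/
theorem norm_comb_sub_one_le_single (ha : 0 ≤ a) (z : Site d) {x : Site d} (hx : (M : ℤ) • z ≤ x)
    (hx' : x ≤ (M : ℤ) • z + fun _ => (M : ℤ) - 1) (μ : Fin d) :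
    ‖((gaugeAct (btree M W z) W x μ : (Matrix n n ℂ)ˣ) : Matrix n n ℂ) - 1‖ ≤ ((d : ℝ) - 1) * ((M : ℝ) - 1) * a := by
  refine (norm_comb_sub_one_le hW hWa z hx μ).trans (mul_le_mul_of_nonneg_right ?_ ha)
  exact l1_lowPart_le_single μ (sub_nonneg.mpr hx) (sub_le_iff_le_add'.mpr hx')

/-- **Double block, uniform**: on `M•z ≤ x ≤ M•z + pairTop M κ` (the block of `z` and its `κ`-neighbour),
`‖(W^{btree})(x, μ) − 1‖ ≤ ((d−1)(M−1) + [κ<μ]·M)·a ≤ d·M·a`. [cite: Balaban1985RegularSpaces, (1.23)–(1.24) p.79] -/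
theorem norm_comb_sub_one_le_pair (ha : 0 ≤ a) (z : Site d) (κ : Fin d) {x : Site d} (hx : (M : ℤ) • z ≤ x)
    (hx' : x ≤ (M : ℤ) • z + pairTop M κ) (μ : Fin d) :
    ‖((gaugeAct (btree M W z) W x μ : (Matrix n n ℂ)ˣ) : Matrix n n ℂ) - 1‖ ≤ (d : ℝ) * M * a := by
  refine (norm_comb_sub_one_le hW hWa z hx μ).trans (mul_le_mul_of_nonneg_right ?_ ha)
  exact l1_lowPart_le_pair' κ μ (sub_nonneg.mpr hx) (sub_le_iff_le_add'.mpr hx')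

/-- The sharper double-block form with the indicator of the doubled direction. [folklore] -/
theorem norm_comb_sub_one_le_pair_sharp (ha : 0 ≤ a) (z : Site d) (κ : Fin d) {x : Site d} (hx : (M : ℤ) • z ≤ x)
    (hx' : x ≤ (M : ℤ) • z + pairTop M κ) (μ : Fin d) :
    ‖((gaugeAct (btree M W z) W x μ : (Matrix n n ℂ)ˣ) : Matrix n n ℂ) - 1‖
      ≤ (((d : ℝ) - 1) * ((M : ℝ) - 1) + (if κ < μ then (M : ℝ) else 0)) * a := by
  refine (norm_comb_sub_one_le hW hWa z hx μ).trans (mul_le_mul_of_nonneg_right ?_ ha)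
  exact l1_lowPart_le_pair κ μ (sub_nonneg.mpr hx) (sub_le_iff_le_add'.mpr hx')

/-- **`κ`-LINES IN THE COMB GAUGE**: `‖(W^{btree})([x, x + i e_κ]) − 1‖ ≤ i · |lowPart κ (x − M•z)|₁ · a` — the per-bond bound is
CONSTANT along the line (the coordinate `κ` is not below `κ`); in particular lines on the comb are `1`-transports.
[cite: Balaban1985Averaging, pp.24–25] -/
theorem norm_hol_comb_seg_sub_one_le (z : Site d) {x : Site d} (hx : (M : ℤ) • z ≤ x) (κ : Fin d) (i : ℕ) :
    ‖((hol (gaugeAct (btree M W z) W) x (seg κ i) : (Matrix n n ℂ)ˣ) : Matrix n n ℂ) - 1‖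
      ≤ i * (l1 (lowPart κ (x - (M : ℤ) • z)) * a) := by
  have h := norm_axial_seg_sub_one_le W (fun y ν => mem_U1_of_unitary (hW y ν))
    (plaqSmall_of_smallField hWa ((M : ℤ) • z) (x + (i : ℤ) • e κ)) ((M : ℤ) • z) (x - (M : ℤ) • z) (sub_nonneg.mpr hx) κ i
    le_rfl (by rw [add_sub_cancel])
  rwa [add_sub_cancel] at h

/-! ## §4 The log form `W₀ = exp A` -/

/-- **LOG FORM**: `(W^{btree})(b) = exp A(b)` with `A(b) := mlog ((W^{btree})(b))`, as soon as `|lowPart μ (x − M•z)|₁·a < 1`.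
[cite: Balaban1985Averaging, (21) p.21, (27) p.22] -/
theorem exp_mlog_comb (z : Site d) {x : Site d} (hx : (M : ℤ) • z ≤ x) (μ : Fin d)
    (hsmall : l1 (lowPart μ (x - (M : ℤ) • z)) * a < 1) :
    exp (mlog ((gaugeAct (btree M W z) W x μ : (Matrix n n ℂ)ˣ) : Matrix n n ℂ)) = gaugeAct (btree M W z) W x μ :=
  exp_mlog ((norm_comb_sub_one_le hW hWa z hx μ).trans_lt hsmall)

/-- `‖A(b)‖ ≤ 2·|lowPart μ (x − M•z)|₁·a` under `|…|₁·a ≤ 1/2`. [cite: Balaban1985Averaging, (27) p.22] -/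
theorem norm_mlog_comb_le (z : Site d) {x : Site d} (hx : (M : ℤ) • z ≤ x) (μ : Fin d)
    (hsmall : l1 (lowPart μ (x - (M : ℤ) • z)) * a ≤ 1 / 2) :
    ‖mlog ((gaugeAct (btree M W z) W x μ : (Matrix n n ℂ)ˣ) : Matrix n n ℂ)‖ ≤ 2 * (l1 (lowPart μ (x - (M : ℤ) • z)) * a) := by
  have h := norm_comb_sub_one_le hW hWa z hx μ
  exact (norm_mlog_le_two_mul (h.trans hsmall)).trans (by linarith)

/-- `A(b)` is skew-adjoint (`𝔲(N)`-valued) under `|…|₁·a ≤ 1/4`: the logarithm of a unitary near `1`. [cite: Balaban1985Averaging, (22)–(23) p.21] -/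
theorem mlog_comb_mem_skewAdjoint (z : Site d) {x : Site d} (hx : (M : ℤ) • z ≤ x) (μ : Fin d)
    (hsmall : l1 (lowPart μ (x - (M : ℤ) • z)) * a ≤ 1 / 4) :
    mlog ((gaugeAct (btree M W z) W x μ : (Matrix n n ℂ)ˣ) : Matrix n n ℂ) ∈ skewAdjoint (Matrix n n ℂ) := by
  letI : CStarAlgebra (Matrix n n ℂ) := {}
  exact skewAdjoint.mem_iff.mpr (star_mlog_eq_neg (mem_unitaryUnits.mp (isUnitaryCfg_comb hW M z x μ))
    ((norm_comb_sub_one_le hW hWa z hx μ).trans hsmall))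

/-! ## §5 Comb loops: the gauge-invariant defect bounds -/

/-- **COMB-LOOP HOLONOMY NEAR `1`**: `‖W(Γ_{q,x} · b · Γ_{q,x+e_μ}⁻¹) − 1‖ ≤ |lowPart μ (x − q)|₁ · a`, `q = M•z ≤ x`.
[cite: Balaban1985Averaging, pp.24–25] -/
theorem norm_hol_combLoop_sub_one_le (z : Site d) {x : Site d} (hx : (M : ℤ) • z ≤ x) (μ : Fin d) :
    ‖((hol W ((M : ℤ) • z) (treeWord (x - (M : ℤ) • z) ++ (μ, true) :: revWord (treeWord (x + e μ - (M : ℤ) • z))) :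
        (Matrix n n ℂ)ˣ) : Matrix n n ℂ) - 1‖ ≤ l1 (lowPart μ (x - (M : ℤ) • z)) * a := by
  rw [hol_combLoop_eq]; exact norm_comb_sub_one_le hW hWa z hx μ

/-- **DEFECT OF THE COMB-GAUGE BOND VARIABLE ON A LIE-ALGEBRA ELEMENT**: `‖Ad_{W₀(b)} X − X‖ ≤ 2·|lowPart μ (x − M•z)|₁·a·‖X‖`. [folklore] -/
theorem norm_Ad_comb_sub_le (z : Site d) {x : Site d} (hx : (M : ℤ) • z ≤ x) (μ : Fin d) (X : Matrix n n ℂ) :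
    ‖Ad (gaugeAct (btree M W z) W x μ) X - X‖ ≤ 2 * (l1 (lowPart μ (x - (M : ℤ) • z)) * a) * ‖X‖ := by
  refine (norm_Ad_sub_le (isUnitaryCfg_comb hW M z x μ) X).trans ?_
  gcongr
  exact norm_comb_sub_one_le hW hWa z hx μ

/-- The same for the inverse: `‖Ad_{W₀(b)⁻¹} X − X‖ ≤ 2·|lowPart μ (x − M•z)|₁·a·‖X‖`. [folklore] -/
theorem norm_Ad_comb_inv_sub_le (z : Site d) {x : Site d} (hx : (M : ℤ) • z ≤ x) (μ : Fin d) (X : Matrix n n ℂ) :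
    ‖Ad (gaugeAct (btree M W z) W x μ)⁻¹ X - X‖ ≤ 2 * (l1 (lowPart μ (x - (M : ℤ) • z)) * a) * ‖X‖ := by
  have hg := isUnitaryCfg_comb hW M z x μ
  refine (norm_Ad_sub_le ((unitaryUnits (Matrix n n ℂ)).inv_mem hg) X).trans ?_
  gcongr
  exact (norm_inv_sub_one_le (mem_U1_of_unitary hg)).trans (norm_comb_sub_one_le hW hWa z hx μ)

/-- **THE COMB-LOOP DEFECT (gauge-invariant form)**: `‖Ad_{W(loop_b)} X − X‖ ≤ 2·|lowPart μ (x − M•z)|₁·a·‖X‖` — the design's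
`‖Ad_{hol(loop_b)} − 1‖ ≤ 2(d−1)Ma`-type bound with the sharp constant. [folklore] -/
theorem norm_Ad_combLoop_sub_le (z : Site d) {x : Site d} (hx : (M : ℤ) • z ≤ x) (μ : Fin d) (X : Matrix n n ℂ) :
    ‖Ad (hol W ((M : ℤ) • z) (treeWord (x - (M : ℤ) • z) ++ (μ, true) :: revWord (treeWord (x + e μ - (M : ℤ) • z)))) X - X‖
      ≤ 2 * (l1 (lowPart μ (x - (M : ℤ) • z)) * a) * ‖X‖ := by
  rw [hol_combLoop_eq]; exact norm_Ad_comb_sub_le hW hWa z hx μ X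

/-- … and with the loop traversed backwards: `‖Ad_{W(loop_b)⁻¹} X − X‖ ≤ 2·|lowPart μ (x − M•z)|₁·a·‖X‖`. [folklore] -/
theorem norm_Ad_combLoop_inv_sub_le (z : Site d) {x : Site d} (hx : (M : ℤ) • z ≤ x) (μ : Fin d) (X : Matrix n n ℂ) :
    ‖Ad (hol W ((M : ℤ) • z) (treeWord (x - (M : ℤ) • z) ++ (μ, true) :: revWord (treeWord (x + e μ - (M : ℤ) • z))))⁻¹ X - X‖
      ≤ 2 * (l1 (lowPart μ (x - (M : ℤ) • z)) * a) * ‖X‖ := by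
  rw [hol_combLoop_eq]; exact norm_Ad_comb_inv_sub_le hW hWa z hx μ X

end Small

end

end Summit.QuantumFields.BalabanUV.T4Continuum.NE3CombGauge
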